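/-
Copyright: harness cell b2b-lgcu-borel (gen 26).  Honest framing: the VALUE here is a THEOREM
(a NEGATIVE verdict on an infinite slice of the crux: `p = 11`, every dimension `m ≥ 3`, every
`ε ≤ 3/4`) — NOT summit progress; the crux item `SubgroupIdentityDesigns`
(stmt-MatrixMultiplication-14079) stays open and untouched.
-/
import Mathlib
import Literature.Barriers.RiemannHypothesis.EpsteinZetaRealZerosIntegralWitness
import Summits.MatrixMultiplication.MatrixMultiplication.Theorems.SubgroupIdentityDesigns.Negative.LevelOneEpsilonCells
import Summits.MatrixMultiplication.MatrixMultiplication.Theorems.SubgroupIdentityDesigns.Negative.LevelOneEpsilonUniform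

/-!
# `p = 11`: no level-one witness for `ε ≤ 3/4` in EVERY dimension `m ≥ 3`

Route `LevelGradedCohnUmans`, crux `SubgroupIdentityDesigns` (OPEN, untouched).  The linear
certificate of `LevelOneEpsilonUniform` (`uniform_master` + `linear_absurd`) is re-run with the
threshold `B₀` as a parameter (`no_levelOne_witness_cert_of_le`).  At `p = 11`, `t = 11/4` the
margin `r − κ₀ s₀ ≈ 0.0095` of the certificate needs `b ≥ 281`; `b ≥ p³ + p² + p + 1 = 1464` holds
from `m = 1 + l ≥ 4` (`cube_succ_le_b`), and the remaining dimension `m = 3` (`b = 133`) is the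
cell theorem `LevelOneEpsilonCells.no_levelOne_witness_three_eleven`.  Together
(`no_levelOne_witness_allDim_eleven`, packaged against the crux clause verbatim in
`no_crux_instance_allDim_eleven`): **at `p = 11` the crux has no instance with `k = 1`, `m ≥ 3`,
`−2 < ε ≤ 3/4`** — the in-tree squeeze `no_levelOne_witness_neumann_eps` gave `ε ≤ 0.684`,
`LevelOneEpsilonUniform.no_levelOne_witness_allDim` gave `7/10`.  (`m = 2` is the business of the
`LevelOneGL2Designs` files and is not restated here.)

What this is NOT: nothing about `k ≥ 2`, nothing above `ε = 3/4`, nothing about the summit.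
VALUE = THEOREM (negative), NOT summit progress.
-/

set_option linter.dupNamespace false

noncomputable section

open scoped BigOperators Classical Matrix
open Module (finrank)

namespace Summit.MatrixMultiplication.MatrixMultiplication.Theorems.SubgroupIdentityDesigns.Negative
namespace LevelOneEpsilonUniformEleven

open Literature.Barriers.MatrixMultiplication (SubgroupTPP)
open Summit.MatrixMultiplication.MatrixMultiplication.Theorems.LieRankDesigns.Negative
open Summit.MatrixMultiplication.MatrixMultiplication.Theorems.LevelOneGL2Designs.Negative
open LevelOneEpsilonUniform (uniform_master linear_absurd)
open LevelOneEpsilonCells (no_levelOne_witness_three_eleven)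
open Literature.Barriers.RiemannHypothesis (le_rpow_of_pow_le)

variable {p : ℕ} [hp : Fact p.Prime] {l : ℕ}

/-- `b ≥ p³ + p² + p + 1` when `l ≥ 3`. -/
theorem cube_succ_le_b (hl : 3 ≤ l) : p ^ 3 + p ^ 2 + p + 1 ≤ (p ^ (1 + l) - 1) / (p - 1) := by
  have hp2 : 2 ≤ p := hp.out.two_le
  rw [Nat.le_div_iff_mul_le (by omega)]
  have hP : p ^ 4 ≤ p ^ (1 + l) := Nat.pow_le_pow_right (by omega) (by omega)
  have h1 : 1 ≤ p ^ (1 + l) := Nat.one_le_pow _ _ (by omega)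
  zify [h1, (show 1 ≤ p by omega)] at hP ⊢
  nlinarith [hP]

/-- The certified verdict with the linear certificate taken at an ARBITRARY threshold
`1 ≤ B₀ ≤ b` (the file `LevelOneEpsilonUniform` fixes `B₀ = p² + p + 1`). -/
theorem no_levelOne_witness_cert_of_le (hl : 1 ≤ l) {ε : ℝ} (hε : -2 < ε) {k n : ℕ}
    (hk : k ≠ 0) (hn : n ≠ 0) (hεt : 2 + ε ≤ (k : ℝ) / n) {r s₀ B₀ : ℝ} (hr0 : 0 ≤ r)
    (hs0 : 0 ≤ s₀) (hB1 : 1 ≤ B₀) (hB0 : B₀ ≤ (((p ^ (1 + l) - 1) / (p - 1) : ℕ) : ℝ))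
    (hr : r ^ k ≤ ((p : ℝ) - 1) ^ n) (hs : (p : ℝ) - 1 ≤ s₀ ^ 2) (hA : 291 / 400 * s₀ ≤ r)
    (hcert : r + 291 / 400 / 2 ≤ (r - 291 / 400 * s₀) * B₀)
    {H₁ H₂ H₃ : Subgroup (GLm p (1 + l))} (htpp : SubgroupTPP H₁ H₂ H₃)
    (hdes : ∃ c : Mat p (1 + l) → ℂ, (∀ M, 1 < M.rank → c M = 0) ∧
      (∑ M, c M * ZMod.stdAddChar (Matrix.trace (M * ((1 : GLm p (1 + l)) : Mat p (1 + l))))) = 1 ∧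
      ∀ a ∈ H₁, ∀ b ∈ H₂, ∀ g ∈ H₃, a * b * g ≠ 1 →
        (∑ M, c M * ZMod.stdAddChar
          (Matrix.trace (M * ((a * b * g : GLm p (1 + l)) : Mat p (1 + l))))) = 0) :
    ¬ budget p (1 + l) 1 (2 + ε) <
      ((Nat.card H₁ * Nat.card H₂ * Nat.card H₃ : ℕ) : ℝ) ^ ((2 + ε) / 3) := by
  intro hlt
  have hp2 : (2 : ℝ) ≤ p := by exact_mod_cast hp.out.two_le
  have hk0 : (0 : ℝ) < k := by exact_mod_cast Nat.pos_of_ne_zero hk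
  have hn0 : (0 : ℝ) < n := by exact_mod_cast Nat.pos_of_ne_zero hn
  have hkne : (k : ℝ) ≠ 0 := hk0.ne'
  have hnne : (n : ℝ) ≠ 0 := hn0.ne'
  have ht0 : (0 : ℝ) < (k : ℝ) / n := div_pos hk0 hn0
  have hM := uniform_master hl hε hεt htpp hdes hlt
  have hP1 : (0 : ℝ) ≤ (p : ℝ) - 1 := by linarith
  have hRt : (((p : ℝ) - 1) ^ ((n : ℝ) / k)) ^ ((k : ℝ) / n) = (p : ℝ) - 1 := by
    rw [← Real.rpow_mul hP1, show (n : ℝ) / k * ((k : ℝ) / n) = 1 by field_simp, Real.rpow_one]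
  have hrR : r ≤ ((p : ℝ) - 1) ^ ((n : ℝ) / k) :=
    le_rpow_of_pow_le hP1 hr0 hk (by field_simp) hr
  exact linear_absurd (pm2 := (p : ℝ) - 2) ht0 hB0 hB1 (by ring) (by linarith)
    (Real.rpow_nonneg hP1 _) hRt hrR hs0 hs (by norm_num) (by norm_num) hA hcert hM

/-- `p = 11`, every dimension `m = 1 + l ≥ 4`: no level-one witness for `−2 < ε ≤ 3/4`
(`t = 11/4`, `r = 23101/10000 ≤ 10^{4/11}`, `s₀ = 31623/10000`, certificate at
`B₀ = 1464 ≤ b`; the margin `r − κ₀ s₀ ≈ 0.0095` needs `b ≥ 281`, which is why `m = 3` (`b = 133`)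
is separate). -/
theorem no_levelOne_witness_eleven_ge_four (hp' : p = 11) (hl : 3 ≤ l) {ε : ℝ} (hε : -2 < ε)
    (hε1 : ε ≤ 3 / 4) {H₁ H₂ H₃ : Subgroup (GLm p (1 + l))} (htpp : SubgroupTPP H₁ H₂ H₃)
    (hdes : ∃ c : Mat p (1 + l) → ℂ, (∀ M, 1 < M.rank → c M = 0) ∧
      (∑ M, c M * ZMod.stdAddChar (Matrix.trace (M * ((1 : GLm p (1 + l)) : Mat p (1 + l))))) = 1 ∧
      ∀ a ∈ H₁, ∀ b ∈ H₂, ∀ g ∈ H₃, a * b * g ≠ 1 →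
        (∑ M, c M * ZMod.stdAddChar
          (Matrix.trace (M * ((a * b * g : GLm p (1 + l)) : Mat p (1 + l))))) = 0) :
    ¬ budget p (1 + l) 1 (2 + ε) <
      ((Nat.card H₁ * Nat.card H₂ * Nat.card H₃ : ℕ) : ℝ) ^ ((2 + ε) / 3) := by
  have hB := cube_succ_le_b (p := p) hl
  subst hp'
  rw [show 11 ^ 3 + 11 ^ 2 + 11 + 1 = 1464 by norm_num] at hB
  have hB0 : (1464 : ℝ) ≤ (((11 ^ (1 + l) - 1) / (11 - 1) : ℕ) : ℝ) := by exact_mod_cast hB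
  exact no_levelOne_witness_cert_of_le (k := 11) (n := 4) (r := 23101 / 10000)
    (s₀ := 31623 / 10000) (B₀ := 1464) (by omega) hε (by norm_num) (by norm_num)
    (by norm_num; linarith [hε1]) (by norm_num) (by norm_num) (by norm_num) hB0 (by norm_num)
    (by norm_num) (by norm_num) (by norm_num) htpp hdes

/-- **`p = 11`, EVERY dimension `m = 1 + l ≥ 3`: no level-one witness for `−2 < ε ≤ 3/4`**
(`m = 3` from `LevelOneEpsilonCells.no_levelOne_witness_three_eleven`, `m ≥ 4` from the linear
certificate at `B₀ = 1464`).  The in-tree squeeze gave `ε ≤ 0.684`,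
`LevelOneEpsilonUniform` `7/10`. -/
theorem no_levelOne_witness_allDim_eleven (hp' : p = 11) (hl : 2 ≤ l) {ε : ℝ} (hε : -2 < ε)
    (hε1 : ε ≤ 3 / 4) {H₁ H₂ H₃ : Subgroup (GLm p (1 + l))} (htpp : SubgroupTPP H₁ H₂ H₃)
    (hdes : ∃ c : Mat p (1 + l) → ℂ, (∀ M, 1 < M.rank → c M = 0) ∧
      (∑ M, c M * ZMod.stdAddChar (Matrix.trace (M * ((1 : GLm p (1 + l)) : Mat p (1 + l))))) = 1 ∧
      ∀ a ∈ H₁, ∀ b ∈ H₂, ∀ g ∈ H₃, a * b * g ≠ 1 →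
        (∑ M, c M * ZMod.stdAddChar
          (Matrix.trace (M * ((a * b * g : GLm p (1 + l)) : Mat p (1 + l))))) = 0) :
    ¬ budget p (1 + l) 1 (2 + ε) <
      ((Nat.card H₁ * Nat.card H₂ * Nat.card H₃ : ℕ) : ℝ) ^ ((2 + ε) / 3) := by
  rcases Nat.eq_or_lt_of_le hl with h | h
  · subst h
    exact no_levelOne_witness_three_eleven hp' hε hε1 htpp hdes
  · exact no_levelOne_witness_eleven_ge_four hp' (by omega) hε hε1 htpp hdes

/-- Packaged against the crux clause verbatim: at `p = 11` the crux `SubgroupIdentityDesigns` has NO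
instance with `k = 1`, any `m ≥ 3` and any `ε ≤ 3/4`. -/
theorem no_crux_instance_allDim_eleven (hp' : p = 11) {ε : ℝ} (hε : -2 < ε) (hε1 : ε ≤ 3 / 4) :
    ¬ ∃ (m : ℕ) (_ : 3 ≤ m)
      (H₁ H₂ H₃ : Subgroup (Matrix.GeneralLinearGroup (Fin m) (ZMod p))),
      Literature.Barriers.MatrixMultiplication.SubgroupTPP H₁ H₂ H₃ ∧
      (∃ c : Matrix (Fin m) (Fin m) (ZMod p) → ℂ, (∀ M, 1 < M.rank → c M = 0) ∧
        (∑ M : Matrix (Fin m) (Fin m) (ZMod p), c M * ZMod.stdAddChar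
          (Matrix.trace (M * ((1 : Matrix.GeneralLinearGroup (Fin m) (ZMod p)) :
            Matrix (Fin m) (Fin m) (ZMod p))))) = 1 ∧
        ∀ a ∈ H₁, ∀ b ∈ H₂, ∀ g ∈ H₃, a * b * g ≠ 1 →
          (∑ M : Matrix (Fin m) (Fin m) (ZMod p), c M * ZMod.stdAddChar
            (Matrix.trace (M * ((a * b * g : Matrix.GeneralLinearGroup (Fin m) (ZMod p)) :
              Matrix (Fin m) (Fin m) (ZMod p))))) = 0) ∧
      (∑ᶠ χ ∈ Literature.RepresentationTheory.FiniteGroups.irrChars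
          (Matrix.GeneralLinearGroup (Fin m) (ZMod p)) ∩
          {f | ∃ c : Matrix (Fin m) (Fin m) (ZMod p) → ℂ, (∀ M, 1 < M.rank → c M = 0) ∧
            ∀ g : Matrix.GeneralLinearGroup (Fin m) (ZMod p), f g =
              ∑ M : Matrix (Fin m) (Fin m) (ZMod p), c M * ZMod.stdAddChar
                (Matrix.trace (M * (g : Matrix (Fin m) (Fin m) (ZMod p))))},
        (χ 1).re ^ (2 + ε)) <
        ((Nat.card H₁ * Nat.card H₂ * Nat.card H₃ : ℕ) : ℝ) ^ ((2 + ε) / 3) := by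
  rintro ⟨m, hm, H₁, H₂, H₃, htpp, hdesign, hlt⟩
  obtain ⟨l, rfl⟩ : ∃ l, m = 1 + l := ⟨m - 1, by omega⟩
  exact no_levelOne_witness_allDim_eleven hp' (by omega) hε hε1 htpp hdesign hlt

end LevelOneEpsilonUniformEleven

end Summit.MatrixMultiplication.MatrixMultiplication.Theorems.SubgroupIdentityDesigns.Negative
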